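import Summits.Ventures.CertifiedManyBodySolver.Downfold.EmeryShapeWindowClosure
import Summits.Ventures.CertifiedManyBodySolver.Downfold.EmeryFermiScalePointsNdNiO2YK26VirtualCorners
import HarnessLib

/-!
# THE ONE-BAND FERMI-SURFACE SHAPE `t′/t` OF THE WHOLE TYPED 3BE BOX `emeryBoxNdNiO2YK26Src (EmeryBoxesKSlicesD)` FROM TWO VIRTUAL CORNERS (two-ray rule + window closure, §B.86;
# router/EMERY-SHAPE-CORNERS.tsv)

Venture CertifiedManyBodySolver, cell `pub/hubbard-downfold` (stage S1; INFLATION-RULES-3to1-B §B.86 (i)), seat hubbard-downfold-mod-4 (technique B, g35); namespace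
`Summit.Ventures.CertifiedManyBodySolver.Downfold.Emery`. Everything PROVED (0 sorry). WHAT THIS IS NOT: a statement about NdNiO₂ ((K)+YNiO₂ proxy source box; n_H 1.09) — the typed box is SCREENING-GRADE (its file's
grade line); `U = 0` one-body kinematics of the σ model (object E = the EXACT `t–t′` shape of the σ Fermi surface, `EmeryFermiSurfaceShape`); no interaction, no `t″`.

For EVERY one-body row `(Δ, t_pd, t_pp, t_pp′) ∈ [397/100, 5] × [117/100, 137/100] × [14/25, 17/25] × [121/1000, 123/1000]` eV and the fillings below, the one-band `t′/t` of the σ-model Fermi surface AT THAT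
ROW'S OWN FERMI ENERGY lies in the window of the table (device: `EmeryShapeTwoRayRule` + `EmeryShapeWindowClosure`, exactly as `EmeryBoxesLa214ShapeCorners`; virtual corners
`V_lo = (3.97, 1.17, 0.68, 0.1494)`, `V_hi = (5, 1.37, 0.56, 0.09965)`, t_pp′ outside the typed range by the factor b₂/b₁ = 1.214 — the explicit 3 → 1 inflation, zero iff the box is pure or of fixed
t_pp′/t_pp ratio; certificates `EmeryFermiScalePointsNdNiO2YK26VirtualCorners`).

| filling | certified window for t′/t over the WHOLE box | V_lo ε_F bracket | V_hi ε_F bracket | lower closure | EMERY-FS-WINDOWS (g19 sub-box device) | object-E row of record [float] |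
|---|---|---|---|---|---|---|
| n_H = 1.09 (ν = 91/200) | **[-0.2369, -0.1681]** | [1.0478, 1.0578] eV | [1.1697, 1.1797] eV | antitone (dd ≥ 1.413 on the window): L = fsRatio(V_lo; e₂) | [-0.2344,-0.1532] (12 sub-boxes, Δ hull [3.97,6.24] × family filling band) | [-0.458,-0.357] |

Sources: three-band model [HybertsenSchluterChristensen1989, Eq. (1)]; [AndersenEtAl1995, §6]; box rows as cited in the typed object's file.
-/

noncomputable section

namespace Summit.Ventures.CertifiedManyBodySolver.Downfold.Emery

open Real Set

/-- **n_H = 1.09 (ν = 91/200): for every row of the box the one-band Fermi-surface `t′/t` (object E, at the row's own Fermi energy) lies in `[-0.2369, -0.1681]`.** Lower closure: antitone; upper: lipschitz. [folklore] -/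
theorem ndNiO2YK26Box_fsRatio_nH109 {Δ a b c : ℝ} (hΔ : Δ ∈ Icc ((397 : ℝ) / 100) (5 : ℝ)) (ha : a ∈ Icc ((117 : ℝ) / 100) ((137 : ℝ) / 100)) (hb : b ∈ Icc ((14 : ℝ) / 25) ((17 : ℝ) / 25)) (hc : c ∈ Icc ((121 : ℝ) / 1000) ((123 : ℝ) / 1000)) :
    fsRatio Δ a b c (fermiEnergyOf Δ a b c ((91 : ℝ) / 200)) ∈ Icc ((-2369 : ℝ) / 10000) ((-1681 : ℝ) / 10000) := by
  have hV : ((123 : ℝ) / 1000) * ((17 : ℝ) / 25) / ((14 : ℝ) / 25) = ((2091 : ℝ) / 14000) := by norm_num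
  have hW : ((121 : ℝ) / 1000) * ((14 : ℝ) / 25) / ((17 : ℝ) / 25) = ((847 : ℝ) / 8500) := by norm_num
  have hVlo := (fermiEnergyOf_of_pointBracketCheck virtPt_NdNiO2YK26Vlo_nH109_br (by norm_num) (by norm_num) (by norm_num) (ν := (91/200 : ℝ)) (by push_cast; exact ⟨le_rfl, le_rfl⟩)).2
  have hVhi := (fermiEnergyOf_of_pointBracketCheck virtPt_NdNiO2YK26Vhi_nH109_br (by norm_num) (by norm_num) (by norm_num) (ν := (91/200 : ℝ)) (by push_cast; exact ⟨le_rfl, le_rfl⟩)).2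
  have hAlo := (fermiEnergyOf_of_pointBracketCheck virtPt_NdNiO2YK26Alo_nH109_br (by norm_num) (by norm_num) (by norm_num) (ν := (91/200 : ℝ)) (by push_cast; exact ⟨le_rfl, le_rfl⟩)).2
  have hTop := (fermiEnergyOf_of_pointBracketCheck virtPt_NdNiO2YK26H_nH109_br (by norm_num) (by norm_num) (by norm_num) (ν := (91/200 : ℝ)) (by push_cast; exact ⟨le_rfl, le_rfl⟩)).2
  push_cast at hVlo hVhi hAlo hTop
  norm_num at hVlo hVhi hAlo hTop
  refine fsRatio_fermiEnergyOf_mem_Icc_windowClosure (Δ₁ := ((397 : ℝ) / 100)) (Δ₂ := (5 : ℝ)) (a₁ := ((117 : ℝ) / 100)) (a₂ := ((137 : ℝ) / 100)) (b₁ := ((14 : ℝ) / 25))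
    (b₂ := ((17 : ℝ) / 25)) (c₁ := ((121 : ℝ) / 1000)) (c₂ := ((123 : ℝ) / 1000)) (e₁ := ((5239 : ℝ) / 5000)) (e₂ := ((5359 : ℝ) / 5000)) (e₃ := 0) (e₄ := ((11797 : ℝ) / 10000)) (by norm_num) (by norm_num) (by norm_num) (by norm_num)
    (by norm_num) hΔ ha hb hc (by norm_num) (by norm_num) ?_ ?_ ?_ (by norm_num) ?_ ?_ ?_ (by norm_num) ?_
  · -- regime at the box's Fermi-energy high corner: c₂ b₂ ε_F(Δ₁, a₂, b₂, c₁) ≤ a₁² b₁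
    nlinarith [hTop.2]
  · rw [hV]; exact hVlo.1
  · exact hAlo.2
  · intro ε hε
    rw [hV]
    have hanti := (fsRatio_mem_Icc_on_window_of_dopingDisc_nonneg (Δ := ((397 : ℝ) / 100)) (a := ((117 : ℝ) / 100)) (b := ((17 : ℝ) / 25)) (c := ((2091 : ℝ) / 14000))
      (p := ((5239 : ℝ) / 5000)) (q := ((5359 : ℝ) / 5000)) (by norm_num) (by norm_num) (by norm_num) (by norm_num) (by norm_num) (by norm_num) (by norm_num)
      (by norm_num [dopingDisc]) hε).1
    refine le_trans ?_ hanti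
    norm_num [fsRatio, fsD, fsN]
  · exact (fermiEnergyOf_pos (by norm_num) (by norm_num) (by norm_num) (by norm_num) (by norm_num) (by norm_num)).le
  · rw [hW]; exact hVhi.2
  · intro ε hε
    rw [hW]
    have hlip := fsRatio_le_on_window (Δ := (5 : ℝ)) (a := ((137 : ℝ) / 100)) (b := ((14 : ℝ) / 25)) (c := ((847 : ℝ) / 8500)) (p := 0) (q := ((11797 : ℝ) / 10000))
      (M := ((2821 : ℝ) / 5000)) (by norm_num) (by norm_num) (by norm_num) (by norm_num) (by norm_num [fsD, fsN]) (by norm_num [dopingDisc]) (by norm_num [dopingDisc]) hε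
    refine le_trans hlip ?_
    norm_num [fsRatio, fsD, fsN]

end Summit.Ventures.CertifiedManyBodySolver.Downfold.Emery
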